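import Summits.BirchSwinnertonDyer.BirchSwinnertonDyer.Theorems.ClassRecordThreeEulerHalvesAtThreeShimuraSwapSupplyB6TDOfMilneOfPoitouTate
import Summits.BirchSwinnertonDyer.BirchSwinnertonDyer.Theorems.ClassRecordThreeEulerHalvesAtThreeLevelSupplyB6TDOfMilneOfPoitouTate
import Summits.BirchSwinnertonDyer.BirchSwinnertonDyer.Theorems.ClassRecordThreeCornerAtThreeMilneTamagawaHolds
import HarnessLib

/-!
# END STATE of the (B6) precision route at `3`: both B6TD port targets and the (DIV)-strengthened primitives on the B6D frame from
# Poitou–Tate ALONE and the B6TD primitives — the Milne I.3.8 input DISCHARGED by corner3-p2 g10's kernel theorem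
# (cell `bsd-stepL`, seat `bsd-stepL-tam3-p1` g15, LINE OWNER of crux 19109; `--supports stmt-BirchSwinnertonDyer-19109 --as helper`)

WHAT (one-call corollaries for the skeletons of 19109 `Lines/inert.lean` r11 and 21420 `Lines/inert.lean` r10, and for the 19065 ∕ 19715
consumers of the shared frame):
* `ShimuraWalk.swapSupplyAtThreeB6TD_of_poitouTate : (∀ K, PT K) → SwapSupplyAtThreeB6TD` and
  `ShimuraWalk.levelSupplyAtThreeB6TD_of_poitouTate : (∀ K, PT K) → LevelSupplyAtThreeB6TD` — tam3-p1 g15's p617322 ∕ p617608 with their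
  displayed hypothesis `hM : Milne2006_localTamagawaNumber_smul_unramifiedClass_eq_zero` fed by
  `MilneTamagawa.Milne2006_localTamagawaNumber_smul_unramifiedClass_eq_zero_holds` (corner3-p2 g10, p619455 — Milne *ADT* I Prop. 3.8, general
  form, a KERNEL theorem);
* `ShimuraWalk.primitivesDivAtThreeInertD_of_poitouTate_of_primitivesWithB6TD : (∀ K, PT K) → PrimitivesWithB6TDAtThree →
  primitivesDivAtThreeInertD` — the (DIV)_D END STATE: Jetchev's `3^{ord₃ c_q}`-divisibility of the labelled CM family of `X_{N⁺,N⁻}` at `3 ∈ S`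
  on the restricted frame follows from Poitou–Tate duality for Selmer structures (citable, Milne I Thm. 4.10) and the printed primitives carrying
  the identity-component label (B6) AT THE CARRIER PRIMES OUTSIDE `S` ONLY (the B6TD glue p615710). The B6D twin is corner3-p2 g9's p610201.
HONEST FRAMING. Three conditional theorems (assembly; no definition, no named fact, no `sorry`); CONDITIONAL on `hPT` and on the beyond-print
`PrimitivesWithB6TDAtThree`; nothing about BSD or any divisibility of a Heegner point is asserted unconditionally; no stub is discharged; no item
closes; 0 classes move (T7); BSD is not proved by any of this. References (locators only): [cite: Jetchev2008, Thm. 1.1, Thm. 1.4, §6]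
[cite: McCallumLMS1991, §5 Prop. 5.2] [cite: MilneADT2006, Ch. I, Prop. 3.8, Thm. 4.10(b)] [cite: Kim2022HigherGZ, Rem. 7.9].
Axioms: `propext`, `Classical.choice`, `Quot.sound`.
-/

set_option autoImplicit false
set_option linter.dupNamespace false

noncomputable section

namespace Summit.BirchSwinnertonDyer.BirchSwinnertonDyer.Theorems.ShimuraWalk

open Literature.NumberTheory.EllipticCurves Literature.NumberTheory.GaloisCohomology
  Summit.BirchSwinnertonDyer.BirchSwinnertonDyer.Theorems

/-- **`(∀ K, PT K) → SwapSupplyAtThreeB6TD`** — Kolyvagin's prime swap for the labelled CM family of `X_{N⁺,N⁻}` at `3 ∈ S` with (B6) only at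
the carrier primes outside `S`, from Poitou–Tate alone (the Milne I.3.8 input is the kernel theorem p619455). [cite: McCallumLMS1991, §5 Prop. 5.2]
[cite: MilneADT2006, Ch. I, Prop. 3.8, Thm. 4.10(b)] -/
theorem swapSupplyAtThreeB6TD_of_poitouTate
    (hPT : ∀ (K : Type) [Field K] [NumberField K], poitouTate_selmerStructure_duality_conj K) :
    SwapSupplyAtThreeB6TD :=
  swapSupplyAtThreeB6TD_of_milne_of_poitouTate MilneTamagawa.Milne2006_localTamagawaNumber_smul_unramifiedClass_eq_zero_holds hPT

/-- **`(∀ K, PT K) → LevelSupplyAtThreeB6TD`** — the ported Jetchev walk's per-level inequality with (B6) only at the carrier primes outside `S`,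
from Poitou–Tate alone (Milne I.3.8 is the kernel theorem p619455). [cite: Jetchev2008, Thm. 1.4, §6 Thm. 6.3, Prop. 6.4]
[cite: MilneADT2006, Ch. I, Prop. 3.8, Thm. 4.10(b)] -/
theorem levelSupplyAtThreeB6TD_of_poitouTate
    (hPT : ∀ (K : Type) [Field K] [NumberField K], poitouTate_selmerStructure_duality_conj K) :
    LevelSupplyAtThreeB6TD :=
  levelSupplyAtThreeB6TD_of_milne_of_poitouTate MilneTamagawa.Milne2006_localTamagawaNumber_smul_unramifiedClass_eq_zero_holds hPT

/-- **(DIV)_D END STATE on the B6TD frame**: `primitivesDivAtThreeInertD` ⟸ {Poitou–Tate for Selmer structures, `PrimitivesWithB6TDAtThree`} —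
the B6TD glue (p615710) over the two port targets above. The B6D twin is p610201. [cite: Jetchev2008, Thm. 1.1, Thm. 1.4 (p. 812)]
[cite: McCallumLMS1991, §5 Prop. 5.2, Cor. 5.6] [cite: MilneADT2006, Ch. I, Thm. 4.10(b)] -/
theorem primitivesDivAtThreeInertD_of_poitouTate_of_primitivesWithB6TD
    (hPT : ∀ (K : Type) [Field K] [NumberField K], poitouTate_selmerStructure_duality_conj K)
    (hprim : PrimitivesWithB6TDAtThree) : primitivesDivAtThreeInertD :=
  primitivesDivAtThreeInertD_of_primitivesWithB6TD_of_swapSupplyB6TD_of_levelSupplyB6TD hprim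
    (swapSupplyAtThreeB6TD_of_poitouTate hPT) (levelSupplyAtThreeB6TD_of_poitouTate hPT)

end Summit.BirchSwinnertonDyer.BirchSwinnertonDyer.Theorems.ShimuraWalk

end
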